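import Literature.Probability.Percolation.GluingAssembly
import Literature.Probability.Percolation.QuadCrossingCutReduction
import HarnessLib

/-!
# Theorem 1.7 of Schramm–Smirnov from the measurable surrogate, connected cuts

Topic `Probability/Percolation`.  Support file (proofs, no named fact) for the named fact
`SchrammSmirnov2011_thm_1_7`: the assembly `SchrammSmirnov2011_thm_1_7_of_surrogate`
(`GluingAssembly.lean`) combined with the reduction to connected cuts
(`SchrammSmirnov2011_thm_1_7_of_connected`, `QuadCrossingCutReduction.lean`): it suffices to
build the measurable surrogate `GluingSurrogate D μ α Q₀` for CONNECTED finite-length cuts `α`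
(and continuity quads `Q₀` in general position) — the form in which the zone geometry
(`CutBlocks.zones`, whose tube is connected only for connected `α`, `CutBlocks.zones_N_conn`) is built.

## References

* O. Schramm, S. Smirnov, *On the scaling limits of planar percolation*, Ann. Probab. 39 (2011)
  1768–1814, arXiv:1101.5820, Thm. 1.7 and Prop. 4.1. [SchrammSmirnov2011]
-/

noncomputable section

open MeasureTheory Set Filter Topology

namespace Literature.Probability.Percolation

namespace QuadCrossing

/-- **Theorem 1.7 for one connected cut from the surrogate** (per `D`, `μ`, `α`). [cite: SchrammSmirnov2011, Thm. 1.7 (proof) and Prop. 4.1] -/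
theorem aeIncluded_iSup_crossingField_of_surrogate {D : Set ℂ} (hD : IsOpen D) (hD' : IsConnected D)
    {μ : FiniteMeasure (QuadConfig D)} (hμ : IsSubseqQuadLimit D μ) {α : Set ℂ}
    (hα : IsFiniteLengthPathUnion α)
    (hsur : ∀ Q₀ : Quad D, (μ : Measure (QuadConfig D)) (frontier (QuadConfig.crossedEvent Q₀)) = 0 →
      (α ∩ frontier Q₀.carrier).Finite → GluingSurrogate D μ α Q₀) :
    AEIncluded (μ : Measure (QuadConfig D)) (inferInstance : MeasurableSpace (QuadConfig D))
      (⨆ x ∈ D \ α, crossingField (connectedComponentIn (D \ α) x)) := by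
  obtain ⟨δs, hpos, h0, hlim⟩ := hμ
  refine aeIncluded_iSup_crossingField_of_dense SchrammSmirnov2011_thm_1_4_holds hD hD'.nonempty
    _ α (dense_setOf_null_frontier_and_finite_inter (μ : Measure (QuadConfig D)) hα)
    fun Q₀ hQ₀ => ?_
  exact exists_measurableSet_crossingField_ae_eq_of_frequently_gluing hD hD'.nonempty hlim hQ₀.1
    fun ε hε => gluingConclusion_of_surrogate hD _ hpos h0 hα Q₀ hQ₀.2 (hsur Q₀ hQ₀.1 hQ₀.2) hε

/-- **Theorem 1.7 from the measurable surrogate for connected cuts.** [cite: SchrammSmirnov2011, Thm. 1.7 (proof) and Prop. 4.1] -/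
theorem SchrammSmirnov2011_thm_1_7_of_connected_surrogate
    (hsur : ∀ (D : Set ℂ), IsOpen D → IsConnected D →
      ∀ (μ : FiniteMeasure (QuadConfig D)), IsSubseqQuadLimit D μ →
      ∀ α : Set ℂ, IsFiniteLengthPathUnion α → IsConnected α →
      ∀ Q₀ : Quad D, (μ : Measure (QuadConfig D)) (frontier (QuadConfig.crossedEvent Q₀)) = 0 →
        (α ∩ frontier Q₀.carrier).Finite → GluingSurrogate D μ α Q₀) :
    SchrammSmirnov2011_thm_1_7 :=
  SchrammSmirnov2011_thm_1_7_of_connected fun D hD hD' μ hμ α hα hαc =>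
    aeIncluded_iSup_crossingField_of_surrogate hD hD' hμ hα (hsur D hD hD' μ hμ α hα hαc)

end QuadCrossing

end Literature.Probability.Percolation

end
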